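import Summits.QuantumFields.YangMills.Theses.BalabanUVNodes
import Summits.QuantumFields.YangMills.Theorems.StabilityBAtRecordR13SepCoPH.Negative.SignBoxAtEveryWitnessFalse
import Summits.QuantumFields.YangMills.Theorems.BalabanUVNodesK1EndOfNodes13PWSOfRunRemAt

/-!
# K1⁷ `StabilityBAtRecordR13SepCoPH` — idea `k1-ceiling-before-world`, EDITION 2 (keyed to the REGISTERED v6 skeleton): the N11-ONLY RAISE and the MATCH-FREE RE-CUT

Cell ym-nodeO-ideate, seat ym-nodeO-idea-2 gen 7, lens `decomp` on `stmt-QuantumFields-20542` (director-ym №24).  A SKETCH (evidence for a crux idea card), not a route file,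
not a skeleton registration: no `sorry`, theorems only over tree declarations + the v6 stub TEXTS restated verbatim (v6 = plan g82 `D82-K1V6/K1Skeleton13SepCoPHv6.lean`
sha16 03f66ac9cc89391f, registered on 20542 2026-08-28T03:16:54Z; it lives outside `lean/`, hence the restatement).

WHAT v6 SAYS.  `stub_nodes13PWS : Inhabited13 F → NodesAtSomeRecord13PWS F` (rung 1: SOME `(θ, h, w)` with the thirteen DAG nodes at `w`) and
`stub_runRows13PWS : NodesAtSomeRecord13PWS F → RunRowsAtSomeRecord13PWS F` (rung 2″: SOME `(θ, h, w)` with nodes AND run rows `b r γ₀ B M` of `β_θ` AND the numeric MATCH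
`B + r ≤ w.βup`).  §2 below (kernel): the HYPOTHESIS of stub 2″ carries NO information on the input world's ceiling letter (`NodesAtSomeRecord13PWS F ↔ ∃ θ h w, w.βup ≤ c ∧ Rung1At F θ h w`
for EVERY `c`, by the landed twin lemma `rung1At_lowerβup`, p602267), while its CONCLUSION wants nodes at a world whose ceiling dominates `B + r`; and the nodes are NOT
re-letterable upward in `βup` (tree `K1BetaWindow13SOfNodes13PWSOfBoxH.nodes_leavesP_reletter_ceiling_of_le`, docstring: «UPWARD is NOT available») — EXCEPT that only ONE of the
thirteen mains, N11 = `Dag.B14_main`, reads `βup` at all (§3, kernel: `nodes_reletter`).  So every proof of stub 2″ contains, besides the β-side rows, a RE-PROOF OF N11 AT A RAISED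
CEILING (with the window shrunk to print's `γ(β′)`), an obligation of the NODES cell that v6's stub text does not display (README D82-K1V6: «STUB-1 WITNESSES should export nodes at a
world with w.βup ≥ band» — informal, and stub 1's ∃-world cannot know the band).

THE RE-CUT (§4, kernel-checked compositions, no sorry):  `Stub1V6` (VERBATIM the registered stub 1)  ∧  `N11CU` («N11 at every ceiling letter `c`, window re-lettered to SOME
`γ' ∈ ]0, w.γ]`, at every rung-1 core datum» = [Balaban1988Convergent] Thm 1 p.262 with the constant `β′` of (2.6) p.255 a PARAMETER and `γ = γ(β′, β₀)` — print's own
quantifier order; nodes cell, size S–M on top of whatever proves N11 inside stub 1)  ∧  `Stub2WF` (v6's stub 2″ with the match conjunct (iii) DELETED and nothing else changed: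
β cell only, world-free in content)  ⟹  `Stub2V6` (★ `stub2V6_of_n11CU_stub2WF`: take `c := B + r`)  and  ⟹  the crux BY NAME (★★ `k1_of_stub1V6_n11CU_stub2WF`, through the
θ-keyed END road of record `K1EndOfNodes13PWSOfRunRemAt.stabilityB_body_of_rung1At_of_runLetters`, p598782 §2).  §5: the β cell's bill for K1 is then EXACTLY K2⁷'s currency —
DEF-1's run letter `RunRemAt F κ θ h c` + the bare drift — with NO numeric side condition (`stub2WF_of_runPairAtCore`; v6's adapter `runRowsAtSomeRecord13PWS_of_runRemAt_drift_match`
minus `hmatch`).  MATCHʳ is dissolved by quantifier order, not paid.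

EDITION 2 vs EDITION 1 (g5, evidence n°30–32; CRIT-1 triage `CRIT-1-TRIAGE-k1-ceiling-before-world.md`: SURVIVES as RE-CUT, VARIANT; addendum: v6 escapes the twin, idea-2's ★ an
ALTERNATIVE cut): g5 asked the WHOLE rung 1 ceiling-uniformly (`Σ₁CU`, XL re-typed); edition 2 keeps stub 1 AS REGISTERED and isolates the ceiling dependence in the ONE node that has it.

HONEST SCOPE.  Bookkeeping over the citation DAG's typed leaves; nothing of Bałaban's analysis is asserted or proved; K1⁷ is NOT closed; `route-QuantumFields-BalabanUVNodes` closes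
only the CONDITIONAL finite-𝕋⁴ rung `BalabanLadder.UV`; [Balaban1989LargeFieldII] Thm 2 ∕ (0.31) p.259 remain unproved in print; the Yang–Mills mass gap (Clay) is NOT proved by
anything here.
-/

noncomputable section

namespace Summit.QuantumFields.YangMills.Cruxes.StabilityBAtRecordR13SepCoPH.Idea2CeilingBeforeWorldV6

open Literature.MathematicalPhysics.QuantumFieldTheory.Balaban1983to89
open Literature.MathematicalPhysics.QuantumFieldTheory.Balaban1983to89.Node00
open DagBinding T4Continuum T4DatumAssembly FlowStepRuns
open FlowStep (HBeta RGEqH prefixOf)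
open Summit.QuantumFields.YangMills.Theorems.StabilityBAtRecordR13SepCoPH.Negative.SignBoxAtEveryWitnessFalse
  (withCeiling Rung1At rung1At_lowerβup nodes_leavesP_lowerβup)
open Summit.QuantumFields.YangMills.BalabanUVNodes.K1BetaWindow13SOfNodes13PWSOfBoxH (nodes_leavesP_reletter_of_le)
open Summit.QuantumFields.YangMills.Theorems.BalabanUVNodesK2NamedJetsRunRemAt (RunRemAt RunConstRemainder runwisePS_of_drift_runConstRemainder)
open Summit.QuantumFields.YangMills.Theorems.BalabanUVNodesK2NamedJetsRemAt (band_of_drift)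
open Summit.QuantumFields.YangMills.Theorems.BalabanUVNodesK2JsOfRecord (StepColourData beta0OfJs)
open Literature.MathematicalPhysics.QuantumFieldTheory.Balaban1983to89.Beta.Drift (OneLoopDrift)
open Summit.QuantumFields.YangMills.Theorems.EndpointGivenBR13SepCoPH.Negative.RemNamedJets13FalseOfTwoNormalisations (oneLoopDrift_const_mul)
open Summit.QuantumFields.YangMills.BalabanUVNodes.K1EndOfNodes13PWSOfRunRemAt (stabilityB_body_of_rung1At_of_runLetters)

/-! ## §1. The v6 texts, VERBATIM (N = 2), and the registered composition reproduced -/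

/-- v6's skeleton-local S-bound record class (VERBATIM `K1Skeleton13SepCoPHV6.RecordS`). -/
def RecordS (F : T4Family) (θ : Stage13HParams F 2) (h : θ.Provisos₁₃SepCoPH F 2) (w : WorldP) : Prop :=
  ∃ (θ' : Stage13HParams F 2) (h' : θ'.Provisos₁₃SepCoPH F 2), θ'.Admissible F 2 ∧
    datumOfRecord₁₃SepCoPH F 2 θ h = datumOfRecord₁₃SepCoPH F 2 θ' h' ∧ w.C = (datumOfRecord₁₃SepCoPH F 2 θ h).C ∧ (0 < w.γ ∧ w.γ ≤ θ'.γ) ∧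
    w.L = (θ'.L : ℝ) ∧ ∀ P : B12.RunParams, w.up P = upOfRecord₅CS F 2 (θ'.toStage5₁₃CoPH F 2) P

/-- v6's rung 0 (VERBATIM `Inhabited13`) = the crux's antecedent. -/
def Inhabited13 (F : T4Family) : Prop :=
  ∃ θ : Stage13HParams F 2, θ.Provisos₁₃SepCoPH F 2 ∧ (θ.ZhUnity F 2 ∧ θ.SlotsNondegenerate₁₃ F 2) ∧ θ.Admissible F 2

/-- v6's rung 1 (VERBATIM `NodesAtSomeRecord13PWS`). -/
def NodesAtSomeRecord13PWS (F : T4Family) : Prop :=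
  ∃ (θ : Stage13HParams F 2) (h : θ.Provisos₁₃SepCoPH F 2) (w : WorldP), (θ.ZhUnity F 2 ∧ θ.SlotsNondegenerate₁₃ F 2) ∧ θ.Admissible F 2 ∧
    RecordS F θ h w ∧ (∀ P : B12.RunParams, Nodes (leavesP w P)) ∧ PrintedUV3V 2 θ.L ∧
    ∃ lam : ResidW F 2, (∀ P : B12.RunParams, 1 ≤ P.K → lam.kSel P < P.K) ∧
      ∀ P : B12.RunParams, lam.kSel P < P.K → ((leavesP w P).rBasicStep ↔ B15Leaf (WOfRecord₁₃ F 2 θ.toStage13Params lam P))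

/-- v6's rung 2″ (VERBATIM `RunRowsAtSomeRecord13PWS`): rung-1 core data AND the run rows `b r γ₀ B M` of `β_θ` AND the match (iii) `B + r ≤ w.βup`. -/
def RunRowsAtSomeRecord13PWS (F : T4Family) : Prop :=
  ∃ (θ : Stage13HParams F 2) (h : θ.Provisos₁₃SepCoPH F 2) (w : WorldP), (θ.ZhUnity F 2 ∧ θ.SlotsNondegenerate₁₃ F 2) ∧ θ.Admissible F 2 ∧
    RecordS F θ h w ∧ (∀ P : B12.RunParams, Nodes (leavesP w P)) ∧
    ∃ (b : ℕ → ℝ) (r γ₀ B M : ℝ), 0 < γ₀ ∧ RunConstRemainder (betaOfRecord₁₃ F 2 θ.toStage13Params) b r γ₀ ∧ (∀ k, b k ≤ B) ∧ B + r ≤ w.βup ∧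
      ∀ (n : ℕ) (gs : ℕ → ℝ), RGEqH n (betaOfRecord₁₃ F 2 θ.toStage13Params) gs → Step.InInterval γ₀ n gs →
        ∀ k, k ≤ n → -M ≤ ∑ j ∈ Finset.Ico k n, betaOfRecord₁₃ F 2 θ.toStage13Params j (prefixOf gs j)

/-- The registered stub 1's TYPE (v5∕v6 `stub_nodes13PWS`). -/
def Stub1V6 : Prop := ∀ F : T4Family, Inhabited13 F → NodesAtSomeRecord13PWS F

/-- The registered stub 2″'s TYPE (v6 `stub_runRows13PWS`). -/
def Stub2V6 : Prop := ∀ F : T4Family, NodesAtSomeRecord13PWS F → RunRowsAtSomeRecord13PWS F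

/-- v6's composition of record, reproduced against the restated texts (= `K1Skeleton13SepCoPHV6.StabilityBAtRecordR13SepCoPH_ofRunRows`, through p598782 §2): stub 1 → stub 2″ → K1⁷ BY NAME. -/
theorem k1_of_stub1V6_stub2V6 (h₁ : Stub1V6) (h₂ : Stub2V6) : Summit.QuantumFields.YangMills.Theses.BalabanUVNodes.StabilityBAtRecordR13SepCoPH := by
  unfold Summit.QuantumFields.YangMills.Theses.BalabanUVNodes.StabilityBAtRecordR13SepCoPH
  intro F hinh
  obtain ⟨θ, h, w, hU, hθ, hR, hnodes, b, r, γ₀, B, M, hγ₀, hrem, hB, hmatch, hps⟩ := h₂ F (h₁ F hinh)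
  exact ⟨θ, h, stabilityB_body_of_rung1At_of_runLetters θ h w hU hθ hR hnodes hγ₀ hrem hB hmatch hps⟩

/-! ## §2. CEILING-BLINDNESS of stub 2″'s hypothesis (kernel; from the landed twin lemma p602267) -/

section Blindness
variable (F : T4Family)

/-- v6's rung 1 IS «some rung-1 witness» in p602267's currency (definitional). -/
theorem nodesAtSomeRecord13PWS_iff_rung1At : NodesAtSomeRecord13PWS F ↔ ∃ (θ : Stage13HParams F 2) (h : θ.Provisos₁₃SepCoPH F 2) (w : WorldP), Rung1At F θ h w :=
  Iff.rfl

/-- **STUB 2″'s HYPOTHESIS DETERMINES NO LOWER BOUND ON THE INPUT CEILING.**  For EVERY real `c`, «some rung-1 witness» ↔ «some rung-1 witness with `w.βup ≤ c`» (twin `withCeiling w (min w.βup c)`,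
`rung1At_lowerβup`).  So the input world of `stub_runRows13PWS` may carry ANY ceiling letter, while its output world must carry one `≥ B + r` with the nodes — every proof of stub 2″
re-worlds, i.e. re-proves N11 at a raised ceiling (§3: N11 is the only `βup`-reading main). [folklore] -/
theorem nodesAtSomeRecord13PWS_iff_belowCeiling (c : ℝ) :
    NodesAtSomeRecord13PWS F ↔ ∃ (θ : Stage13HParams F 2) (h : θ.Provisos₁₃SepCoPH F 2) (w : WorldP), w.βup ≤ c ∧ Rung1At F θ h w := by
  refine ⟨fun ⟨θ, h, w, hr⟩ => ⟨θ, h, withCeiling w (min w.βup c), min_le_right _ _, rung1At_lowerβup F hr (min_le_left _ _)⟩, fun ⟨θ, h, w, _, hr⟩ => ⟨θ, h, w, hr⟩⟩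

/-- In particular stub 2″ is EQUIVALENT to its restriction to inputs with ceiling letter `≤ -1` (where no β-row match `B + r ≤ w.βup` with an AF-signed `β_θ` can hold AT the input world). [folklore] -/
theorem stub2V6_iff_fromLowCeiling : Stub2V6 ↔
    ∀ F : T4Family, (∃ (θ : Stage13HParams F 2) (h : θ.Provisos₁₃SepCoPH F 2) (w : WorldP), w.βup ≤ -1 ∧ Rung1At F θ h w) → RunRowsAtSomeRecord13PWS F :=
  ⟨fun h₂ F hF => h₂ F ((nodesAtSomeRecord13PWS_iff_belowCeiling F (-1)).2 hF), fun h₂ F hF => h₂ F ((nodesAtSomeRecord13PWS_iff_belowCeiling F (-1)).1 hF)⟩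

end Blindness

/-! ## §3. The N11-ONLY RAISE: re-lettering `(βup, γ) ↦ (c, γ')`, `γ' ≤ w.γ`, costs exactly `Dag.B14_main` at the new binding -/

/-- The world with its ceiling letter replaced by `c` and its window letter by `γ'` (print's order: `β′` given, then `γ = γ(β′, β₀)`; [Balaban1988Convergent] (2.6) p.255). [folklore] -/
def reletter (w : WorldP) (c γ' : ℝ) : WorldP := { w with βup := c, γ := γ' }

@[simp] theorem reletter_βup (w : WorldP) (c γ' : ℝ) : (reletter w c γ').βup = c := rfl
@[simp] theorem reletter_γ (w : WorldP) (c γ' : ℝ) : (reletter w c γ').γ = γ' := rfl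
@[simp] theorem reletter_C (w : WorldP) (c γ' : ℝ) : (reletter w c γ').C = w.C := rfl
@[simp] theorem reletter_up (w : WorldP) (c γ' : ℝ) : (reletter w c γ').up = w.up := rfl
/-- At the unchanged window the re-lettering is p602267's `withCeiling` (definitional). -/
theorem reletter_self_γ (w : WorldP) (c : ℝ) : reletter w c w.γ = withCeiling w c := rfl

/-- **THE N11-ONLY RAISE LEMMA.**  Nodes at `w` for the run `P` + N11 = `Dag.B14_main` at the re-lettered binding `reletter w c γ'` (`γ' ≤ w.γ`, ANY `c`) ⟹ all thirteen nodes at the re-lettered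
binding: the other twelve mains do not read `βup` and are antitone in `γ` (tree `nodes_leavesP_reletter_of_le`, dag-n24-w1), so they transfer for free; N11 reads `flowControl = (2.6) with β′ := βup`
as a hypothesis and does NOT transfer upward — it is the hypothesis here.  [cite: Balaban1989LargeFieldII, Introduction pp.355–356 (the DAG); Balaban1988Convergent, Thm 1 p.262, (2.6) p.255 (bookkeeping)] -/
theorem nodes_reletter (w : WorldP) {c γ' : ℝ} (hγ' : γ' ≤ w.γ) (P : B12.RunParams) (hn : Nodes (leavesP w P))
    (h14 : Dag.B14_main (leavesP (reletter w c γ') P)) : Nodes (leavesP (reletter w c γ') P) := by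
  obtain ⟨h4, h5, h6, h7, h8, h9, h10, h11, h12, h13, -, h15, h16⟩ := nodes_leavesP_reletter_of_le w hγ' w.b_pos P hn
  exact ⟨h4, h5, h6, h7, h8, h9, h10, h11, h12, h13, h14, h15, h16⟩

/-- Downward (and same-window) re-lettering of N11 is FREE: for `c ≤ w.βup`, N11 at `reletter w c w.γ` from the nodes at `w` ((2.6) with a smaller constant is stronger; p602267 `nodes_leavesP_lowerβup`).
Only the UPWARD half of `N11CU` below has content. [cite: Balaban1988Convergent, (2.6) p.255 (bookkeeping)] -/
theorem b14_main_reletter_of_le (w : WorldP) {c : ℝ} (hc : c ≤ w.βup) (P : B12.RunParams) (hn : Nodes (leavesP w P)) :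
    Dag.B14_main (leavesP (reletter w c w.γ) P) := by
  obtain ⟨-, -, -, -, -, -, -, -, -, -, h14, -, -⟩ := nodes_leavesP_lowerβup w hc P hn
  exact h14

section Pieces
variable (F : T4Family)

/-- Rung-1 CORE data at `(θ, h, w)`: the four leading conjuncts common to v6's rungs 1 and 2″ (unity, admissibility, S-bound record class, nodes at every run). -/
def Core13 (θ : Stage13HParams F 2) (h : θ.Provisos₁₃SepCoPH F 2) (w : WorldP) : Prop :=
  (θ.ZhUnity F 2 ∧ θ.SlotsNondegenerate₁₃ F 2) ∧ θ.Admissible F 2 ∧ RecordS F θ h w ∧ ∀ P : B12.RunParams, Nodes (leavesP w P)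

/-- The S-bound record class does not read `βup` and accepts any smaller positive window. [cite: Balaban1989LargeFieldII, Thm 1 p.355 (bookkeeping)] -/
theorem recordS_reletter {θ : Stage13HParams F 2} {h : θ.Provisos₁₃SepCoPH F 2} {w : WorldP} (hR : RecordS F θ h w) (c : ℝ) {γ' : ℝ} (hγ'0 : 0 < γ') (hγ' : γ' ≤ w.γ) :
    RecordS F θ h (reletter w c γ') := by
  obtain ⟨θ', h', hθ', hD, hC, hγ, hL, hup⟩ := hR
  exact ⟨θ', h', hθ', hD, hC, ⟨hγ'0, hγ'.trans hγ.2⟩, hL, hup⟩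

/-- Core data pass to the re-lettered world given N11 there. [folklore] -/
theorem core13_reletter {θ : Stage13HParams F 2} {h : θ.Provisos₁₃SepCoPH F 2} {w : WorldP} (hc : Core13 F θ h w) (c : ℝ) {γ' : ℝ} (hγ'0 : 0 < γ') (hγ' : γ' ≤ w.γ)
    (h14 : ∀ P : B12.RunParams, Dag.B14_main (leavesP (reletter w c γ') P)) : Core13 F θ h (reletter w c γ') := by
  obtain ⟨hU, hθ, hR, hnodes⟩ := hc
  exact ⟨hU, hθ, recordS_reletter F hR c hγ'0 hγ', fun P => nodes_reletter w hγ' P (hnodes P) (h14 P)⟩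

/-- The full rung-1 data (p602267 `Rung1At`: core + `PrintedUV3V` + the [IV]-pin) pass as well — neither extra conjunct reads `βup` or `γ`. [folklore] -/
theorem rung1At_reletter {θ : Stage13HParams F 2} {h : θ.Provisos₁₃SepCoPH F 2} {w : WorldP} (hr : Rung1At F θ h w) (c : ℝ) {γ' : ℝ} (hγ'0 : 0 < γ') (hγ' : γ' ≤ w.γ)
    (h14 : ∀ P : B12.RunParams, Dag.B14_main (leavesP (reletter w c γ') P)) : Rung1At F θ h (reletter w c γ') := by
  obtain ⟨hU, hθ, hR, hnodes, h08, lam, hsel, hpin⟩ := hr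
  exact ⟨hU, hθ, recordS_reletter F hR c hγ'0 hγ', fun P => nodes_reletter w hγ' P (hnodes P) (h14 P), h08, lam, hsel, fun P hP => hpin P hP⟩

end Pieces

/-! ## §4. THE RE-CUT: `Stub1V6 ∧ N11CU ∧ Stub2WF ⟹ Stub2V6` and `⟹ K1⁷` BY NAME (kernel-checked, no sorry) -/

/-- **PIECE `N11CU` — N11 CEILING-UNIFORM AT RUNG-1 CORE DATA** (the nodes cell's hidden share of stub 2″, typed): at every `(θ, h, w)` carrying v6's core data and for EVERY ceiling letter `c`,
SOME window `γ' ∈ ]0, w.γ]` such that N11 = `Dag.B14_main` holds at the binding `leavesP (reletter w c γ') P` of every run — i.e. [Balaban1988Convergent] Thm 1 p.262 at the record with the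
constant `β′` of (2.6) p.255 a PARAMETER and `γ = γ(β′, β₀)` (print's order: «with some positive constants β′, β₀», then γ small).  The half `c ≤ w.βup` is free (`b14_main_reletter_of_le`);
the content is the upward half.  Printed WITH proof ([III] is «this whole paper»); size S–M on top of the method proving N11 inside stub 1. [cite: Balaban1988Convergent, Thm 1 p.262, (2.6)–(2.9) p.255] -/
def N11CU : Prop :=
  ∀ (F : T4Family) (θ : Stage13HParams F 2) (h : θ.Provisos₁₃SepCoPH F 2) (w : WorldP), Core13 F θ h w →
    ∀ c : ℝ, ∃ γ' : ℝ, 0 < γ' ∧ γ' ≤ w.γ ∧ ∀ P : B12.RunParams, Dag.B14_main (leavesP (reletter w c γ') P)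

/-- The DOWNWARD half of `N11CU` is free: for `c ≤ w.βup` take `γ' := w.γ` (`b14_main_reletter_of_le`; `0 < w.γ` from the record class).  Only ceilings ABOVE the witness's letter cost an N11 re-proof. [folklore] -/
theorem n11CU_below_free (F : T4Family) (θ : Stage13HParams F 2) (h : θ.Provisos₁₃SepCoPH F 2) (w : WorldP) (hc : Core13 F θ h w) {c : ℝ} (hle : c ≤ w.βup) :
    ∃ γ' : ℝ, 0 < γ' ∧ γ' ≤ w.γ ∧ ∀ P : B12.RunParams, Dag.B14_main (leavesP (reletter w c γ') P) := by
  obtain ⟨-, -, ⟨θ', h', -, -, -, hγ, -, -⟩, hnodes⟩ := hc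
  exact ⟨w.γ, hγ.1, le_rfl, fun P => b14_main_reletter_of_le w hle P (hnodes P)⟩

/-- **PIECE `Stub2WF` — v6's STUB 2″ WITH THE MATCH CONJUNCT (iii) DELETED** (nothing else changed): SOME `(θ, h, w)` with the core data and the run rows `b r γ₀ B M` of `β_θ` — run-wise constant
remainder, `b ≤ B`, run-wise partial-sum floor `−M` — and NO clause relating `B + r` to `w.βup`.  β cell only; world-free in content (the rows read `θ` alone). [cite: Balaban1987RG1, Thm 3 p.264, (1.22) p.264, (5.10) p.293; Balaban1988LargeFieldsRG2, (2.41) p.21] -/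
def RunRowsWFAtSomeRecord13PWS (F : T4Family) : Prop :=
  ∃ (θ : Stage13HParams F 2) (h : θ.Provisos₁₃SepCoPH F 2) (w : WorldP), (θ.ZhUnity F 2 ∧ θ.SlotsNondegenerate₁₃ F 2) ∧ θ.Admissible F 2 ∧
    RecordS F θ h w ∧ (∀ P : B12.RunParams, Nodes (leavesP w P)) ∧
    ∃ (b : ℕ → ℝ) (r γ₀ B M : ℝ), 0 < γ₀ ∧ RunConstRemainder (betaOfRecord₁₃ F 2 θ.toStage13Params) b r γ₀ ∧ (∀ k, b k ≤ B) ∧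
      ∀ (n : ℕ) (gs : ℕ → ℝ), RGEqH n (betaOfRecord₁₃ F 2 θ.toStage13Params) gs → Step.InInterval γ₀ n gs →
        ∀ k, k ≤ n → -M ≤ ∑ j ∈ Finset.Ico k n, betaOfRecord₁₃ F 2 θ.toStage13Params j (prefixOf gs j)

/-- `Stub2WF` as a stub TYPE (hypothesis = the registered stub 1's conclusion, verbatim). -/
def Stub2WF : Prop := ∀ F : T4Family, NodesAtSomeRecord13PWS F → RunRowsWFAtSomeRecord13PWS F

/-- Sanity (the deletion is a weakening): v6's stub 2″ implies the match-free stub. [folklore] -/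
theorem stub2WF_of_stub2V6 (h₂ : Stub2V6) : Stub2WF := fun F hF => by
  obtain ⟨θ, h, w, hU, hθ, hR, hnodes, b, r, γ₀, B, M, hγ₀, hrem, hB, -, hps⟩ := h₂ F hF
  exact ⟨θ, h, w, hU, hθ, hR, hnodes, b, r, γ₀, B, M, hγ₀, hrem, hB, hps⟩

/-- **★ THE RE-CUT REFINES v6: `N11CU ∧ Stub2WF ⟹ Stub2V6`.**  Given the match-free rows `b r γ₀ B M` at `(θ, h, w)`, RE-LETTER THE WORLD AFTER THE CEILING IS KNOWN: `c := B + r`, `γ' := N11CU's window`;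
the core data pass to `reletter w (B + r) γ'` (§3) and the match holds there by `le_rfl`.  So the registered skeleton can keep `stub_runRows13PWS` and staff it as these two suppliers. [folklore] -/
theorem stub2V6_of_n11CU_stub2WF (hN : N11CU) (h₂ : Stub2WF) : Stub2V6 := fun F hF => by
  obtain ⟨θ, h, w, hU, hθ, hR, hnodes, b, r, γ₀, B, M, hγ₀, hrem, hB, hps⟩ := h₂ F hF
  obtain ⟨γ', hγ'0, hγ', h14⟩ := hN F θ h w ⟨hU, hθ, hR, hnodes⟩ (B + r)
  obtain ⟨hU', hθ', hR', hnodes'⟩ := core13_reletter F ⟨hU, hθ, hR, hnodes⟩ (B + r) hγ'0 hγ' h14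
  exact ⟨θ, h, reletter w (B + r) γ', hU', hθ', hR', hnodes', b, r, γ₀, B, M, hγ₀, hrem, hB, le_rfl, hps⟩

/-- **★★ THE THREE-PIECE COMPOSITION TO THE CRUX BY NAME: `Stub1V6 → N11CU → Stub2WF → K1⁷`** (v6's END road of record after ★).  Pieces: registered stub 1 (nodes cell, XL, unchanged) ·
`N11CU` (nodes cell, S–M) · `Stub2WF` (β cell, L; = K2⁷'s run currency + drift by §5).  No numeric MATCH item anywhere. [folklore] -/
theorem k1_of_stub1V6_n11CU_stub2WF (h₁ : Stub1V6) (hN : N11CU) (h₂ : Stub2WF) :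
    Summit.QuantumFields.YangMills.Theses.BalabanUVNodes.StabilityBAtRecordR13SepCoPH :=
  k1_of_stub1V6_stub2V6 h₁ (stub2V6_of_n11CU_stub2WF hN h₂)

/-! ## §5. The β cell's bill under the re-cut = K2⁷'s run letter + the bare drift, NO match (v6's adapter minus `hmatch`) -/

section BetaBill
variable {F : T4Family}

/-- **THE ROWS FROM THE RUN LETTER AND THE DRIFT, NO MATCH** (= the β-side lines of v6's adapter `runRowsAtSomeRecord13PWS_of_runRemAt_drift_match` with the hypothesis `hmatch` deleted):
DEF-1's run letter `RunRemAt F κ θ h c` and the bare drift of the named numbers give the rows of `β_θ` (`b := c·β₀ˢ(κ)`, `r := s`, `B := c·stepBal 2 F.L + 2|c|A`, `M := 2|c|A`) — a statement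
about `θ` alone. [cite: Balaban1987RG1, Thm 3 p.264, (1.20)–(1.22) p.264, (2.12)–(2.14) p.268, (5.10) p.293 (bookkeeping)] -/
theorem rows_of_runRemAt_drift (θ : Stage13HParams F 2) (h : θ.Provisos₁₃SepCoPH F 2) (κ : StepColourData) {c A : ℝ} (hRun : RunRemAt F κ θ h c)
    (hdrift : OneLoopDrift (B12Normalization.stepBal 2 F.L) A (beta0OfJs F κ)) :
    ∃ (b : ℕ → ℝ) (r γ₀ B M : ℝ), 0 < γ₀ ∧ RunConstRemainder (betaOfRecord₁₃ F 2 θ.toStage13Params) b r γ₀ ∧ (∀ k, b k ≤ B) ∧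
      ∀ (n : ℕ) (gs : ℕ → ℝ), RGEqH n (betaOfRecord₁₃ F 2 θ.toStage13Params) gs → Step.InInterval γ₀ n gs →
        ∀ k, k ≤ n → -M ≤ ∑ j ∈ Finset.Ico k n, betaOfRecord₁₃ F 2 θ.toStage13Params j (prefixOf gs j) := by
  obtain ⟨γ₀, s, hγ₀, -, hcap, hrem, -, -⟩ := hRun
  have hd := oneLoopDrift_const_mul hdrift c
  have hband : ∀ k, c * beta0OfJs F κ k ≤ c * B12Normalization.stepBal 2 F.L + 2 * (|c| * A) := fun k => by
    have := (abs_le.mp (band_of_drift hd k)).2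
    linarith
  exact ⟨fun k => c * beta0OfJs F κ k, s, γ₀, _, _, hγ₀, hrem, hband, runwisePS_of_drift_runConstRemainder hd hrem hcap⟩

/-- **ADAPTER WITHOUT THE MATCH** at core data `(θ, h, w)`: the match-free rung 2″. [folklore] -/
theorem runRowsWF_of_runRemAt_drift (θ : Stage13HParams F 2) (h : θ.Provisos₁₃SepCoPH F 2) (w : WorldP)
    (hU : θ.ZhUnity F 2 ∧ θ.SlotsNondegenerate₁₃ F 2) (hθ : θ.Admissible F 2) (hR : RecordS F θ h w) (hnodes : ∀ P : B12.RunParams, Nodes (leavesP w P))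
    (κ : StepColourData) {c A : ℝ} (hRun : RunRemAt F κ θ h c) (hdrift : OneLoopDrift (B12Normalization.stepBal 2 F.L) A (beta0OfJs F κ)) :
    RunRowsWFAtSomeRecord13PWS F := by
  obtain ⟨b, r, γ₀, B, M, hγ₀, hrem, hB, hps⟩ := rows_of_runRemAt_drift θ h κ hRun hdrift
  exact ⟨θ, h, w, hU, hθ, hR, hnodes, b, r, γ₀, B, M, hγ₀, hrem, hB, hps⟩

end BetaBill

/-- **THE β CELL's K1 BILL, TYPED**: at every rung-1 core datum, SOME step-colour data `κ`, normalisation `c` and drift defect `A` with DEF-1's run letter and the bare drift — K2⁷ v6's two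
β-rows read AT the witness's `θ`, with NO ceiling clause. -/
def RunPairAtCore : Prop :=
  ∀ (F : T4Family) (θ : Stage13HParams F 2) (h : θ.Provisos₁₃SepCoPH F 2) (w : WorldP), Core13 F θ h w →
    ∃ (κ : StepColourData) (c A : ℝ), RunRemAt F κ θ h c ∧ OneLoopDrift (B12Normalization.stepBal 2 F.L) A (beta0OfJs F κ)

/-- `RunPairAtCore ⟹ Stub2WF` (keep stub 1's witness; no re-worlding on the β side). [folklore] -/
theorem stub2WF_of_runPairAtCore (hP : RunPairAtCore) : Stub2WF := fun F hF => by
  obtain ⟨θ, h, w, hU, hθ, hR, hnodes, -⟩ := hF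
  obtain ⟨κ, c, A, hRun, hdrift⟩ := hP F θ h w ⟨hU, hθ, hR, hnodes⟩
  exact runRowsWF_of_runRemAt_drift θ h w hU hθ hR hnodes κ hRun hdrift

/-- ★★′ The same composition with the β bill in K2⁷'s currency: `Stub1V6 → N11CU → RunPairAtCore → K1⁷` BY NAME. [folklore] -/
theorem k1_of_stub1V6_n11CU_runPairAtCore (h₁ : Stub1V6) (hN : N11CU) (hP : RunPairAtCore) :
    Summit.QuantumFields.YangMills.Theses.BalabanUVNodes.StabilityBAtRecordR13SepCoPH :=
  k1_of_stub1V6_n11CU_stub2WF h₁ hN (stub2WF_of_runPairAtCore hP)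

/-! ## §6. TWO-PIECE VARIANT (same-datum keying): the nodes cell exports N11 ceiling-uniformly AT ITS OWN witness, the β cell supplies rows AT EVERY core datum -/

/-- β rows ∀-keyed at core data (K2⁷'s keying «at every tuple», here at every rung-1 core datum; world-free in content). [cite: Balaban1987RG1, Thm 3 p.264, (5.10) p.293 (bookkeeping)] -/
def RowsAtCore : Prop :=
  ∀ (F : T4Family) (θ : Stage13HParams F 2) (h : θ.Provisos₁₃SepCoPH F 2) (w : WorldP), Core13 F θ h w →
    ∃ (b : ℕ → ℝ) (r γ₀ B M : ℝ), 0 < γ₀ ∧ RunConstRemainder (betaOfRecord₁₃ F 2 θ.toStage13Params) b r γ₀ ∧ (∀ k, b k ≤ B) ∧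
      ∀ (n : ℕ) (gs : ℕ → ℝ), RGEqH n (betaOfRecord₁₃ F 2 θ.toStage13Params) gs → Step.InInterval γ₀ n gs →
        ∀ k, k ≤ n → -M ≤ ∑ j ∈ Finset.Ico k n, betaOfRecord₁₃ F 2 θ.toStage13Params j (prefixOf gs j)

/-- STUB 1 EXPORTING N11 CEILING-UNIFORMLY at its own witness (edition 1's `Σ₁CU` cut down to the one `βup`-reading node): SOME core datum `(θ, h, w)` AND, for every ceiling letter `c`, SOME window
`γ' ∈ ]0, w.γ]` with N11 at `reletter w c γ'` on every run. [cite: Balaban1988Convergent, Thm 1 p.262, (2.6) p.255 (bookkeeping)] -/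
def Stub1N11CU : Prop :=
  ∀ F : T4Family, Inhabited13 F → ∃ (θ : Stage13HParams F 2) (h : θ.Provisos₁₃SepCoPH F 2) (w : WorldP), Core13 F θ h w ∧
    ∀ c : ℝ, ∃ γ' : ℝ, 0 < γ' ∧ γ' ≤ w.γ ∧ ∀ P : B12.RunParams, Dag.B14_main (leavesP (reletter w c γ') P)

/-- `Stub1V6 ∧ N11CU ⟹ Stub1N11CU` (forget `PrintedUV3V` and the [IV]-pin, which the END road does not read). [folklore] -/
theorem stub1N11CU_of_stub1V6_n11CU (h₁ : Stub1V6) (hN : N11CU) : Stub1N11CU := fun F hinh => by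
  obtain ⟨θ, h, w, hU, hθ, hR, hnodes, -⟩ := h₁ F hinh
  exact ⟨θ, h, w, ⟨hU, hθ, hR, hnodes⟩, hN F θ h w ⟨hU, hθ, hR, hnodes⟩⟩

/-- `RowsAtCore ⟹ Stub2WF` and `RunPairAtCore ⟹ RowsAtCore` (§5's adapter). [folklore] -/
theorem stub2WF_of_rowsAtCore (hρ : RowsAtCore) : Stub2WF := fun F hF => by
  obtain ⟨θ, h, w, hU, hθ, hR, hnodes, -⟩ := hF
  obtain ⟨b, r, γ₀, B, M, hγ₀, hrem, hB, hps⟩ := hρ F θ h w ⟨hU, hθ, hR, hnodes⟩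
  exact ⟨θ, h, w, hU, hθ, hR, hnodes, b, r, γ₀, B, M, hγ₀, hrem, hB, hps⟩

theorem rowsAtCore_of_runPairAtCore (hP : RunPairAtCore) : RowsAtCore := fun F θ h w hc => by
  obtain ⟨κ, c, A, hRun, hdrift⟩ := hP F θ h w hc
  exact rows_of_runRemAt_drift θ h κ hRun hdrift

/-- **★★″ TWO-PIECE COMPOSITION: `Stub1N11CU → RowsAtCore → K1⁷` BY NAME** — the ceiling is read off the β rows at stub 1's OWN datum, then the world is re-lettered (`c := B + r`); no θ re-choice, no match item. [folklore] -/
theorem k1_of_stub1N11CU_rowsAtCore (h₁ : Stub1N11CU) (hρ : RowsAtCore) : Summit.QuantumFields.YangMills.Theses.BalabanUVNodes.StabilityBAtRecordR13SepCoPH := by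
  unfold Summit.QuantumFields.YangMills.Theses.BalabanUVNodes.StabilityBAtRecordR13SepCoPH
  intro F hinh
  obtain ⟨θ, h, w, hc, hcu⟩ := h₁ F hinh
  obtain ⟨b, r, γ₀, B, M, hγ₀, hrem, hB, hps⟩ := hρ F θ h w hc
  obtain ⟨γ', hγ'0, hγ', h14⟩ := hcu (B + r)
  obtain ⟨hU', hθ', hR', hnodes'⟩ := core13_reletter F hc (B + r) hγ'0 hγ' h14
  exact ⟨θ, h, stabilityB_body_of_rung1At_of_runLetters θ h (reletter w (B + r) γ') hU' hθ' hR' hnodes' hγ₀ hrem hB le_rfl hps⟩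

/-! ## §7. CAPPED VARIANT (honest fallback if [III]'s «numerous restrictions» bound `β′` absolutely): N11 up to a CONSTANT `cmax` fixed in the TEXT, rows matched against that constant — still world-free -/

/-- N11 at every ceiling letter `c ≤ cmax` (window re-lettered), at every rung-1 core datum. [cite: Balaban1988Convergent, Thm 1 p.262, (2.6) p.255 (bookkeeping)] -/
def N11CUUpTo (cmax : ℝ) : Prop :=
  ∀ (F : T4Family) (θ : Stage13HParams F 2) (h : θ.Provisos₁₃SepCoPH F 2) (w : WorldP), Core13 F θ h w →
    ∀ c : ℝ, c ≤ cmax → ∃ γ' : ℝ, 0 < γ' ∧ γ' ≤ w.γ ∧ ∀ P : B12.RunParams, Dag.B14_main (leavesP (reletter w c γ') P)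

/-- v6's stub 2″ with the witness letter `w.βup` in (iii) REPLACED BY THE CONSTANT `cmax` (a number published in the route text, e.g. print's absolute bound if there is one): world-free, immune to the twin. -/
def RunRowsCappedAtSomeRecord13PWS (cmax : ℝ) (F : T4Family) : Prop :=
  ∃ (θ : Stage13HParams F 2) (h : θ.Provisos₁₃SepCoPH F 2) (w : WorldP), (θ.ZhUnity F 2 ∧ θ.SlotsNondegenerate₁₃ F 2) ∧ θ.Admissible F 2 ∧
    RecordS F θ h w ∧ (∀ P : B12.RunParams, Nodes (leavesP w P)) ∧
    ∃ (b : ℕ → ℝ) (r γ₀ B M : ℝ), 0 < γ₀ ∧ RunConstRemainder (betaOfRecord₁₃ F 2 θ.toStage13Params) b r γ₀ ∧ (∀ k, b k ≤ B) ∧ B + r ≤ cmax ∧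
      ∀ (n : ℕ) (gs : ℕ → ℝ), RGEqH n (betaOfRecord₁₃ F 2 θ.toStage13Params) gs → Step.InInterval γ₀ n gs →
        ∀ k, k ≤ n → -M ≤ ∑ j ∈ Finset.Ico k n, betaOfRecord₁₃ F 2 θ.toStage13Params j (prefixOf gs j)

/-- the capped stub TYPE. -/
def Stub2Capped (cmax : ℝ) : Prop := ∀ F : T4Family, NodesAtSomeRecord13PWS F → RunRowsCappedAtSomeRecord13PWS cmax F

/-- ★‴ `N11CUUpTo cmax ∧ Stub2Capped cmax ⟹ Stub2V6` (re-letter to `c := B + r ≤ cmax`). [folklore] -/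
theorem stub2V6_of_capped (cmax : ℝ) (hN : N11CUUpTo cmax) (h₂ : Stub2Capped cmax) : Stub2V6 := fun F hF => by
  obtain ⟨θ, h, w, hU, hθ, hR, hnodes, b, r, γ₀, B, M, hγ₀, hrem, hB, hcap, hps⟩ := h₂ F hF
  obtain ⟨γ', hγ'0, hγ', h14⟩ := hN F θ h w ⟨hU, hθ, hR, hnodes⟩ (B + r) hcap
  obtain ⟨hU', hθ', hR', hnodes'⟩ := core13_reletter F ⟨hU, hθ, hR, hnodes⟩ (B + r) hγ'0 hγ' h14
  exact ⟨θ, h, reletter w (B + r) γ', hU', hθ', hR', hnodes', b, r, γ₀, B, M, hγ₀, hrem, hB, le_rfl, hps⟩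

/-- `N11CU ⟹ N11CUUpTo cmax` and `Stub2Capped cmax ⟹ Stub2WF` (the capped pieces sit between the two cuts). [folklore] -/
theorem n11CUUpTo_of_n11CU (cmax : ℝ) (hN : N11CU) : N11CUUpTo cmax := fun F θ h w hc c _ => hN F θ h w hc c

theorem stub2WF_of_stub2Capped (cmax : ℝ) (h₂ : Stub2Capped cmax) : Stub2WF := fun F hF => by
  obtain ⟨θ, h, w, hU, hθ, hR, hnodes, b, r, γ₀, B, M, hγ₀, hrem, hB, -, hps⟩ := h₂ F hF
  exact ⟨θ, h, w, hU, hθ, hR, hnodes, b, r, γ₀, B, M, hγ₀, hrem, hB, hps⟩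

end Summit.QuantumFields.YangMills.Cruxes.StabilityBAtRecordR13SepCoPH.Idea2CeilingBeforeWorldV6

end
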